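import Summits.Ventures.DiscreteObjects.Hadamard.Order167WilliamsonIff668
import Summits.Ventures.DiscreteObjects.Hadamard.Order167NormalizerSmall668
import Summits.Ventures.DiscreteObjects.Hadamard.Order167InvertingInvolution668

/-!
# H(668): inverting an element of order 167 whose centraliser has index 4 — every inverting automorphism is a
# pair-involution, one of its `V₄`-translates preserves all blocks with `4 + 4` fixed points and commutes with the
# quaternion labels (kernel; group step of the symmetric-Williamson iff)

Framing: lottery ticket; floor = certified bounds/negative ranges.

Cell pub-namedobj (venture DiscreteObjects), target (H), hadamard gen 22.  Setting of gen 21 (`Order167WilliamsonIff668`):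
`σ = (π, κ, d, e)` a signed automorphism of a Hadamard matrix `H` of order `668` with `π^167 = κ^167 = 1`, `(π, κ) ≠ (1,1)`;
`τ₁, τ₂` signed automorphisms commuting with `σ` (pairs) whose pairs are DISTINCT non-trivial involutions (index-4 centraliser,
the Williamson-type case); and now in addition a signed automorphism `ρ = (π', κ', d', e')` INVERTING `σ`:
`π'π = π^μ π'`, `κ'κ = κ^μ κ'`, `μ ≡ 166 (mod 167)` — so `|N(⟨σ⟩) : ±⟨σ⟩| = 8`, the maximum allowed by gen 21
(`|C(σ) : ±⟨σ⟩| ≤ 4`, `N/C ≤ C₂`).  Kernel consequences (tools for `Order167WilliamsonSymmetric668`):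
* `signs_const_of_normalizing`: sign constancy along `σ`-orbits for a NORMALISING signed automorphism of the re-signed matrix
  (the λ-argument of gen 20/21 for a general multiplier).
* **`inverting_sq_eq_one_of_mem_orbFin`**: an inverting `ρ` that maps SOME row into its own `σ`-orbit is a pair-involution
  (`π'² = κ'² = 1`) [`ρ²` centralises `σ` and preserves that orbit, so `ρ² ∈ ⟨σ⟩` by the free action (gen 21); and
  `ρ² = σ^c` with `ρ` inverting `σ` forces `σ^{2c} = 1`].
* **`exists_blockPreserving_inverting`**: with the index-4 centraliser, SOME translate `τ_g ρ` (`g ∈ V₄`,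
  `τ_g = τ₁^{g₁} τ₂^{g₂}`) preserves every row orbit and every column orbit of `σ`, is a pair-involution and fixes exactly `4`
  rows and `4` columns [the pair group `⟨σ⟩ × V₄` is transitive on rows (gen 21), so some `τ_g ρ` maps a row into its own
  orbit; then the previous lemma and the all-or-none theorem for inverting involutions (gen 21) apply].
* **`inverting_involution_commute_label`**: a block-preserving inverting pair-involution with a fixed row COMMUTES (pairs)
  with every centralising involution `τ` [`(ρτ)` is inverting and maps the fixed row into its own orbit, so `(ρτ)² = 1`].
* **`hadamard668_index_four_inverting_sq_eq_one`**: hence, when the centraliser has index `4`, EVERY automorphism inverting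
  `σ` is a pair-involution — `N(⟨σ⟩)/±⟨σ⟩` is then elementary abelian of order `8` at the pair level (no elements of pair
  order `4`; compare `hadamard668_order167_normalizer_orderOf_mem`).
STRUCTURE of a hypothetical object; no automorphism order and no Hadamard order is excluded; H(668) untouched; HITS 0/4.
Ours; no `sorry`, no definitions, default heartbeats.
-/

namespace Summit.Ventures.DiscreteObjects.Hadamard

open Finset BigOperators Matrix

open Literature.Combinatorics.Designs.GoethalsSeidel (IsHadamardMatrix)

variable {ι : Type*} [Fintype ι] [DecidableEq ι]

/-! ### tools -/

omit [Fintype ι] [DecidableEq ι] in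
/-- the identity pair with trivial signs is a signed automorphism -/
lemma isSignedAut_trivial (H : Matrix ι ι ℤ) : IsSignedAut H 1 1 (fun _ => 1) (fun _ => 1) :=
  ⟨fun _ => Or.inl rfl, fun _ => Or.inl rfl, fun i j => by
    rw [Equiv.Perm.one_apply, Equiv.Perm.one_apply, one_mul, one_mul]⟩

omit [Fintype ι] [DecidableEq ι] in
/-- two involutions (or trivial maps) whose product is an involution (or trivial) commute -/
lemma commute_of_three_squares {a b : Equiv.Perm ι} (ha : a ^ 2 = 1) (hb : b ^ 2 = 1) (hab : (a * b) ^ 2 = 1) :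
    Commute a b := by
  have ha' : a * a = 1 := by rw [← pow_two]; exact ha
  have hb' : b * b = 1 := by rw [← pow_two]; exact hb
  have hab' : a * b * (a * b) = 1 := by rw [← pow_two]; exact hab
  show a * b = b * a
  calc a * b = a * b * (a * (b * b) * a) := by rw [hb', mul_one, ha', mul_one]
    _ = (a * b * (a * b)) * (b * a) := by simp only [mul_assoc]
    _ = b * a := by rw [hab', one_mul]

omit [Fintype ι] [DecidableEq ι] in
/-- **sign constancy (λ-argument, normalising case).**  If `(π, κ)` is a permutation automorphism of a matrix `H'` with
non-zero entries, `π ^ p = 1` with `p` odd, and `(P, Q, D, E)` is a signed automorphism of `H'` with `Pπ = π^μ P`,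
`Qκ = κ^μ Q`, then `D` is constant along `π`-orbits and `E` along `κ`-orbits. -/
lemma signs_const_of_normalizing {H' : Matrix ι ι ℤ} (hne0 : ∀ i j, H' i j ≠ 0) {π κ P Q : Equiv.Perm ι} {D E : ι → ℤ}
    (hinv : ∀ i j, H' (π i) (κ j) = H' i j) {p : ℕ} (hodd : Odd p) (hπ : π ^ p = 1)
    (hτ : IsSignedAut H' P Q D E) {μ : ℕ} (hnP : P * π = π ^ μ * P) (hnQ : Q * κ = κ ^ μ * Q) (x₀ : ι) :
    (∀ k x, D ((π ^ k) x) = D x) ∧ (∀ k y, E ((κ ^ k) y) = E y) := by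
  obtain ⟨hD, hE, hτ⟩ := hτ
  have hinvm : ∀ m i j, H' ((π ^ m) i) ((κ ^ m) j) = H' i j := perm_aut_pow hinv
  have key : ∀ x y, D (π x) * E (κ y) * H' x y = D x * E y * H' x y := by
    intro x y
    have h1 : H' (P (π x)) (Q (κ y)) = D (π x) * E (κ y) * H' x y := by rw [hτ, hinv]
    rw [norm_apply hnP x, norm_apply hnQ y, hinvm, hτ] at h1
    exact h1.symm
  have hlam : ∀ x, D (π x) = (E x₀ * E (κ x₀)) * D x := by
    intro x
    have h := key x x₀
    have h2 : D (π x) * E (κ x₀) = D x * E x₀ := by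
      have : (D (π x) * E (κ x₀) - D x * E x₀) * H' x x₀ = 0 := by linarith
      rcases mul_eq_zero.mp this with h0 | h0
      · linarith
      · exact (hne0 x x₀ h0).elim
    calc D (π x) = D (π x) * (E (κ x₀) * E (κ x₀)) := by rw [pm_mul_self (hE _), mul_one]
      _ = (D (π x) * E (κ x₀)) * E (κ x₀) := by ring
      _ = (E x₀ * E (κ x₀)) * D x := by rw [h2]; ring
  have hlampm : E x₀ * E (κ x₀) = 1 ∨ E x₀ * E (κ x₀) = -1 := by
    rcases hE x₀ with h1 | h1 <;> rcases hE (κ x₀) with h2 | h2 <;> simp [h1, h2]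
  have hlampow : ∀ k x, D ((π ^ k) x) = (E x₀ * E (κ x₀)) ^ k * D x := by
    intro k; induction k with
    | zero => intro x; simp
    | succ k ih => intro x; rw [pow_succ', Equiv.Perm.mul_apply, hlam, ih, pow_succ]; ring
  have hlam1 : E x₀ * E (κ x₀) = 1 := by
    rcases hlampm with h | h
    · exact h
    · exfalso
      have h1 := hlampow p x₀
      rw [hπ, Equiv.Perm.one_apply, h, Odd.neg_one_pow hodd] at h1
      exact pm_ne_zero (hD x₀) (by linarith)
  have hdπ : ∀ x, D (π x) = D x := fun x => by rw [hlam, hlam1, one_mul]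
  have heκ : ∀ y, E (κ y) = E y := by
    intro y
    have h := key x₀ y
    rw [hdπ] at h
    have hne : D x₀ * H' x₀ y ≠ 0 := mul_ne_zero (pm_ne_zero (hD x₀)) (hne0 x₀ y)
    have : (E (κ y) - E y) * (D x₀ * H' x₀ y) = 0 := by linarith
    rcases mul_eq_zero.mp this with h0 | h0
    · linarith
    · exact (hne h0).elim
  refine ⟨fun k => ?_, fun k => ?_⟩
  · induction k with
    | zero => intro x; simp
    | succ k ih => intro x; rw [pow_succ', Equiv.Perm.mul_apply, hdπ, ih]
  · induction k with
    | zero => intro y; simp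
    | succ k ih => intro y; rw [pow_succ', Equiv.Perm.mul_apply, heκ, ih]

/-! ### inverting elements that preserve an orbit are pair-involutions -/

omit [Fintype ι] [DecidableEq ι] in
/-- `π^((μ+1) c) = 1` when `π^167 = 1` and `μ ≡ 166 (mod 167)` -/
lemma pow_mu_succ_mul_eq_one {π : Equiv.Perm ι} (hπ : π ^ 167 = 1) {μ : ℕ} (hμ : μ % 167 = 166) (c : ℕ) :
    π ^ (μ * c + c) = 1 := by
  have hμ' : (μ : ZMod 167) = -1 := by
    rw [← ZMod.natCast_mod μ 167, hμ]; exact zmod167_166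
  have h : π ^ (μ * c + c) = π ^ 0 := by
    apply pow_eq_pow_of_natCast_eq_n hπ
    push_cast
    rw [hμ']; ring
  rw [h, pow_zero]

section inverting
variable {H : Matrix ι ι ℤ} (hH : IsHadamardMatrix H) (hι : Fintype.card ι = 668)
  {π κ π' κ' : Equiv.Perm ι} {d e d' e' : ι → ℤ} (haut : IsSignedAut H π κ d e)
  (hπ : π ^ 167 = 1) (hκ : κ ^ 167 = 1) (hne : π ≠ 1 ∨ κ ≠ 1)
  (haut' : IsSignedAut H π' κ' d' e') {μ : ℕ} (hnπ : π' * π = π ^ μ * π') (hnκ : κ' * κ = κ ^ μ * κ')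
  (hμ : μ % 167 = 166)
include hH hι haut hπ hκ hne haut' hnπ hnκ hμ

omit haut' hnκ in
/-- an inverting automorphism has non-trivial row part (`π` is fixed-point-free of order `167`, and `π' = 1` would give
`π = π^μ`, `π² = π^(μ+1) = 1`) -/
lemma inverting_fst_ne_one : π' ≠ 1 := by
  have h167 := hadamard668_fixedRows_167 hH hι π κ d e haut hπ hκ hne
  obtain ⟨x⟩ : Nonempty ι := Fintype.card_pos_iff.mp (by rw [hι]; norm_num)
  intro h1
  rw [h1, one_mul, mul_one] at hnπ
  have h2 : π ^ (2 * 1) = 1 := by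
    have h3 : π ^ (μ * 1 + 1) = 1 := pow_mu_succ_mul_eq_one hπ hμ 1
    rw [mul_one, pow_succ, ← hnπ] at h3
    rw [mul_one, pow_two]; exact h3
  have h3 := pow_eq_one_of_sq_pow_167 hπ h2
  rw [pow_one] at h3
  exact moved_of_card_fixed_eq_zero π h167.1 x (by rw [h3, Equiv.Perm.one_apply])

/-- **An inverting automorphism whose SQUARE maps some row into its own `σ`-orbit is a pair-involution.**  [`ρ²`
centralises `σ` (gen 20/21) and preserves that orbit, so `ρ² = σ^c` as a pair by the free action
(`hadamard668_order167_centralizer_eq_of_sameOrbit` against the identity); `ρ` commutes with `ρ² = σ^c` and inverts `σ`, so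
`σ^(2c) = 1`, `σ^c = 1`.] -/
theorem inverting_sq_eq_one_of_sq_mem_orbFin {x₀ : ι} (hx : (π' ^ 2) x₀ ∈ orbFin π 167 x₀) :
    π' ^ 2 = 1 ∧ κ' ^ 2 = 1 := by
  obtain ⟨hc2, hc2'⟩ := hadamard668_order167_normalizer_sq_centralizes hH hι haut hπ hκ hne haut' hnπ hnκ
  have hx2 : (π' ^ 2) x₀ ∈ orbFin π 167 ((1 : Equiv.Perm ι) x₀) := by rw [Equiv.Perm.one_apply]; exact hx
  obtain ⟨c, h1, h2⟩ := hadamard668_order167_centralizer_eq_of_sameOrbit hH hι haut hπ hκ hne (isSignedAut_trivial H)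
    (isSignedAut_pow haut' 2) (Commute.one_left π) (Commute.one_left κ) hc2 hc2' hx2
  rw [one_mul] at h1 h2
  have hπc : π ^ c = 1 := by
    apply pow_eq_one_of_sq_pow_167 hπ
    have h3 : π' * π ^ c = π ^ c * π' := by rw [← h1, ← pow_succ', ← pow_succ]
    rw [norm_comm_pow hnπ c] at h3
    have h4 : π ^ (μ * c) = π ^ c := mul_right_cancel h3
    calc π ^ (2 * c) = π ^ (μ * c) * π ^ c := by rw [h4, ← pow_add, two_mul]
      _ = π ^ (μ * c + c) := by rw [pow_add]
      _ = 1 := pow_mu_succ_mul_eq_one hπ hμ c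
  have hκc : κ ^ c = 1 := by
    apply pow_eq_one_of_sq_pow_167 hκ
    have h3 : κ' * κ ^ c = κ ^ c * κ' := by rw [← h2, ← pow_succ', ← pow_succ]
    rw [norm_comm_pow hnκ c] at h3
    have h4 : κ ^ (μ * c) = κ ^ c := mul_right_cancel h3
    calc κ ^ (2 * c) = κ ^ (μ * c) * κ ^ c := by rw [h4, ← pow_add, two_mul]
      _ = κ ^ (μ * c + c) := by rw [pow_add]
      _ = 1 := pow_mu_succ_mul_eq_one hκ hμ c
  exact ⟨h1.trans hπc, h2.trans hκc⟩

/-- **An inverting automorphism that maps some row into its own `σ`-orbit is a pair-involution.** -/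
theorem inverting_sq_eq_one_of_mem_orbFin {x₀ : ι} (hx : π' x₀ ∈ orbFin π 167 x₀) : π' ^ 2 = 1 ∧ κ' ^ 2 = 1 := by
  apply inverting_sq_eq_one_of_sq_mem_orbFin hH hι haut hπ hκ hne haut' hnπ hnκ hμ (x₀ := x₀)
  obtain ⟨c, -, hcx⟩ := Finset.mem_image.mp hx
  rw [pow_two, Equiv.Perm.mul_apply, ← hcx, norm_apply_pow hnπ c x₀, ← hcx, ← Equiv.Perm.mul_apply, ← pow_add]
  exact pow_apply_mem_orbFin π (by norm_num) hπ x₀ _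

/-- so an inverting automorphism mapping some row into its own orbit preserves EVERY row orbit and EVERY column orbit and
fixes exactly `4` rows and `4` columns (all-or-none theorem of gen 21) -/
theorem inverting_blocks_of_mem_orbFin {x₀ : ι} (hx : π' x₀ ∈ orbFin π 167 x₀) :
    (∀ x, π' x ∈ orbFin π 167 x) ∧ (∀ y, κ' y ∈ orbFin κ 167 y) ∧
      (univ.filter fun x => π' x = x).card = 4 ∧ (univ.filter fun y => κ' y = y).card = 4 := by
  obtain ⟨h2, h2'⟩ := inverting_sq_eq_one_of_mem_orbFin hH hι haut hπ hκ hne haut' hnπ hnκ hμ hx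
  have hne' : π' ≠ 1 ∨ κ' ≠ 1 := Or.inl (inverting_fst_ne_one hH hι haut hπ hκ hne hnπ hμ)
  rcases hadamard668_order167_inverting_involution hH hι haut hπ hκ hne haut' hnπ hnκ hμ h2 h2' hne' with
    h | ⟨hno, -⟩
  · exact h
  · exact absurd hx (hno x₀)

/-- **A block-preserving inverting pair-involution with a fixed row commutes (pairs) with every centralising involution**
`τ = (π₁, κ₁)` (`π₁π = ππ₁`, `κ₁κ = κκ₁`, `π₁² = κ₁² = 1`).  [`ρτ` inverts `σ` and `(ρτ)²` maps the fixed row `x₁` into its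
own orbit, so `(ρτ)² = 1` at the pair level; three involutions `ρ, τ, ρτ` ⇒ `ρτ = τρ`.] -/
theorem inverting_involution_commute_label {π₁ κ₁ : Equiv.Perm ι} {d₁ e₁ : ι → ℤ} (h₁ : IsSignedAut H π₁ κ₁ d₁ e₁)
    (hc₁ : Commute π₁ π) (hc₁' : Commute κ₁ κ) (hi₁ : π₁ ^ 2 = 1) (hi₁' : κ₁ ^ 2 = 1) (h2 : π' ^ 2 = 1)
    (h2' : κ' ^ 2 = 1) (hrows : ∀ x, π' x ∈ orbFin π 167 x) {x₁ : ι} (hx₁ : π' x₁ = x₁) :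
    Commute π' π₁ ∧ Commute κ' κ₁ := by
  have hψ := isSignedAut_mul haut' h₁
  have hn₁ : π₁ * π = π ^ 1 * π₁ := by rw [pow_one]; exact hc₁.eq
  have hn₁' : κ₁ * κ = κ ^ 1 * κ₁ := by rw [pow_one]; exact hc₁'.eq
  have hnψ : (π' * π₁) * π = π ^ μ * (π' * π₁) := by have h := norm_mul hnπ hn₁; rwa [mul_one] at h
  have hnψ' : (κ' * κ₁) * κ = κ ^ μ * (κ' * κ₁) := by have h := norm_mul hnκ hn₁'; rwa [mul_one] at h
  have hx : ((π' * π₁) ^ 2) x₁ ∈ orbFin π 167 x₁ := by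
    obtain ⟨k, -, hk⟩ := Finset.mem_image.mp (hrows (π₁ x₁))
    have e1 : π' (π₁ x₁) = π₁ ((π ^ k) x₁) := by
      rw [← hk, ← Equiv.Perm.mul_apply, ← Equiv.Perm.mul_apply, (hc₁.pow_right k).eq]
    have e2 : π₁ (π₁ ((π ^ k) x₁)) = (π ^ k) x₁ := by
      rw [← Equiv.Perm.mul_apply, ← pow_two, hi₁, Equiv.Perm.one_apply]
    rw [pow_two, Equiv.Perm.mul_apply, Equiv.Perm.mul_apply, Equiv.Perm.mul_apply, e1, e2, norm_apply_pow hnπ k x₁, hx₁]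
    exact pow_apply_mem_orbFin π (by norm_num) hπ x₁ _
  obtain ⟨hs, hs'⟩ := inverting_sq_eq_one_of_sq_mem_orbFin hH hι haut hπ hκ hne hψ hnψ hnψ' hμ hx
  exact ⟨commute_of_three_squares h2 hi₁ hs, commute_of_three_squares h2' hi₁' hs'⟩

end inverting

/-! ### the index-4 situation: a block-preserving translate; every inverting element is a pair-involution -/

section indexfour
variable {H : Matrix ι ι ℤ} (hH : IsHadamardMatrix H) (hι : Fintype.card ι = 668)
  {π κ : Equiv.Perm ι} {d e : ι → ℤ} (haut : IsSignedAut H π κ d e)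
  (hπ : π ^ 167 = 1) (hκ : κ ^ 167 = 1) (hne : π ≠ 1 ∨ κ ≠ 1)
  {π₁ κ₁ π₂ κ₂ : Equiv.Perm ι} {d₁ e₁ d₂ e₂ : ι → ℤ}
  (h₁ : IsSignedAut H π₁ κ₁ d₁ e₁) (h₂ : IsSignedAut H π₂ κ₂ d₂ e₂) (hc₁ : Commute π₁ π) (hc₁' : Commute κ₁ κ)
  (hc₂ : Commute π₂ π) (hc₂' : Commute κ₂ κ) (hi₁ : π₁ ^ 2 = 1) (hi₁' : κ₁ ^ 2 = 1) (hi₂ : π₂ ^ 2 = 1)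
  (hi₂' : κ₂ ^ 2 = 1) (hne₁ : π₁ ≠ 1 ∨ κ₁ ≠ 1) (hne₂ : π₂ ≠ 1 ∨ κ₂ ≠ 1) (hne₁₂ : π₁ ≠ π₂ ∨ κ₁ ≠ κ₂)
  {π' κ' : Equiv.Perm ι} {d' e' : ι → ℤ} (haut' : IsSignedAut H π' κ' d' e')
  {μ : ℕ} (hnπ : π' * π = π ^ μ * π') (hnκ : κ' * κ = κ ^ μ * κ') (hμ : μ % 167 = 166)
include hH hι haut hπ hκ hne h₁ h₂ hc₁ hc₁' hc₂ hc₂' hi₁ hi₁' hi₂ hi₂' hne₁ hne₂ hne₁₂ haut' hnπ hnκ hμ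

/-- **A block-preserving translate.**  With the index-4 centraliser, some `τ_g ρ` (`τ_g = τ₁^{g₁} τ₂^{g₂}`, `g ∈ V₄`) is an
inverting signed automorphism that preserves every row orbit and every column orbit of `σ`, is a pair-involution and fixes
exactly `4` rows and `4` columns. -/
theorem exists_blockPreserving_inverting : ∃ g : ZMod 2 × ZMod 2,
    (∃ D E : ι → ℤ, IsSignedAut H (π₁ ^ g.1.val * π₂ ^ g.2.val * π') (κ₁ ^ g.1.val * κ₂ ^ g.2.val * κ') D E) ∧
    (π₁ ^ g.1.val * π₂ ^ g.2.val * π') * π = π ^ μ * (π₁ ^ g.1.val * π₂ ^ g.2.val * π') ∧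
    (κ₁ ^ g.1.val * κ₂ ^ g.2.val * κ') * κ = κ ^ μ * (κ₁ ^ g.1.val * κ₂ ^ g.2.val * κ') ∧
    (π₁ ^ g.1.val * π₂ ^ g.2.val * π') ^ 2 = 1 ∧ (κ₁ ^ g.1.val * κ₂ ^ g.2.val * κ') ^ 2 = 1 ∧
    (∀ x, (π₁ ^ g.1.val * π₂ ^ g.2.val * π') x ∈ orbFin π 167 x) ∧
    (∀ y, (κ₁ ^ g.1.val * κ₂ ^ g.2.val * κ') y ∈ orbFin κ 167 y) ∧
    (univ.filter fun x => (π₁ ^ g.1.val * π₂ ^ g.2.val * π') x = x).card = 4 ∧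
    (univ.filter fun y => (κ₁ ^ g.1.val * κ₂ ^ g.2.val * κ') y = y).card = 4 := by
  obtain ⟨⟨hcomm, -⟩, -, -⟩ :=
    centralizer167_involutions_commute hH hι haut hπ hκ hne h₁ h₂ hc₁ hc₁' hc₂ hc₂' hi₁ hi₁' hi₂ hi₂'
  set P : ZMod 2 × ZMod 2 → Equiv.Perm ι := fun g => π₁ ^ g.1.val * π₂ ^ g.2.val with hPdef
  set Q : ZMod 2 × ZMod 2 → Equiv.Perm ι := fun g => κ₁ ^ g.1.val * κ₂ ^ g.2.val with hQdef
  have hT : ∀ g, ∃ D E : ι → ℤ, IsSignedAut H (P g) (Q g) D E :=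
    fun g => ⟨_, _, isSignedAut_mul (isSignedAut_pow h₁ g.1.val) (isSignedAut_pow h₂ g.2.val)⟩
  have hcR : ∀ g, Commute (P g) π := fun g => (hc₁.pow_left _).mul_left (hc₂.pow_left _)
  have hcC : ∀ g, Commute (Q g) κ := fun g => (hc₁'.pow_left _).mul_left (hc₂'.pow_left _)
  have hPsq : ∀ g, P g ^ 2 = 1 := by
    intro g
    show (π₁ ^ g.1.val * π₂ ^ g.2.val) ^ 2 = 1
    rw [pow_two, ← v4_label_add hi₁ hi₂ hcomm, v4_facts.1 g]; simp
  obtain ⟨x₀⟩ : Nonempty ι := Fintype.card_pos_iff.mp (by rw [hι]; norm_num)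
  -- transitivity of ⟨σ⟩ × V₄ on rows (gen 21): π' x₀ = π^s (P g x₀)
  have hcardV : Fintype.card ((ZMod 2 × ZMod 2) × ZMod 167) = 668 := by simp [ZMod.card]
  have hbR : Function.Bijective (fun a : (ZMod 2 × ZMod 2) × ZMod 167 => (π ^ a.2.val) (P a.1 x₀)) := by
    rw [Fintype.bijective_iff_injective_and_card]
    exact ⟨v4_orbitMap_injective hH hι haut hπ hκ hne h₁ h₂ hc₁ hc₁' hc₂ hc₂' hi₁ hi₁' hi₂ hi₂' hne₁ hne₂ hne₁₂ x₀,
      by rw [hcardV, hι]⟩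
  obtain ⟨⟨g, s⟩, hgs⟩ := hbR.2 (π' x₀)
  simp only at hgs
  obtain ⟨Dg, Eg, hTg⟩ := hT g
  have hρ := isSignedAut_mul hTg haut'
  have hn₁ : P g * π = π ^ 1 * P g := by rw [pow_one]; exact (hcR g).eq
  have hn₁' : Q g * κ = κ ^ 1 * Q g := by rw [pow_one]; exact (hcC g).eq
  have hnρ : (P g * π') * π = π ^ μ * (P g * π') := by have h := norm_mul hn₁ hnπ; rwa [one_mul] at h
  have hnρ' : (Q g * κ') * κ = κ ^ μ * (Q g * κ') := by have h := norm_mul hn₁' hnκ; rwa [one_mul] at h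
  -- τ_g ρ maps x₀ into its own orbit
  have hx : (P g * π') x₀ ∈ orbFin π 167 x₀ := by
    have e1 : P g ((π ^ s.val) (P g x₀)) = (π ^ s.val) x₀ := by
      rw [← Equiv.Perm.mul_apply, ((hcR g).pow_right s.val).eq, Equiv.Perm.mul_apply, ← Equiv.Perm.mul_apply (P g) (P g),
        ← pow_two, hPsq, Equiv.Perm.one_apply]
    rw [Equiv.Perm.mul_apply, ← hgs, e1]
    exact pow_apply_mem_orbFin π (by norm_num) hπ x₀ _
  obtain ⟨hrows, hcols, hcr, hcc⟩ := inverting_blocks_of_mem_orbFin hH hι haut hπ hκ hne hρ hnρ hnρ' hμ hx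
  obtain ⟨hs2, hs2'⟩ := inverting_sq_eq_one_of_mem_orbFin hH hι haut hπ hκ hne hρ hnρ hnρ' hμ hx
  exact ⟨g, ⟨_, _, hρ⟩, hnρ, hnρ', hs2, hs2', hrows, hcols, hcr, hcc⟩

/-- **With an index-4 centraliser, every automorphism inverting `σ` is a pair-involution** (`π'² = κ'² = 1`): the
normaliser quotient `N(⟨σ⟩)/±⟨σ⟩` is then elementary abelian of order `8` at the pair level. -/
theorem hadamard668_index_four_inverting_sq_eq_one : π' ^ 2 = 1 ∧ κ' ^ 2 = 1 := by
  obtain ⟨⟨hcomm, hcomm'⟩, -, -⟩ :=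
    centralizer167_involutions_commute hH hι haut hπ hκ hne h₁ h₂ hc₁ hc₁' hc₂ hc₂' hi₁ hi₁' hi₂ hi₂'
  obtain ⟨g, ⟨D, E, hρ⟩, hnρ, hnρ', hs2, hs2', hrows, -, hcr, -⟩ := exists_blockPreserving_inverting hH hι haut hπ hκ hne
    h₁ h₂ hc₁ hc₁' hc₂ hc₂' hi₁ hi₁' hi₂ hi₂' hne₁ hne₂ hne₁₂ haut' hnπ hnκ hμ
  set Pg : Equiv.Perm ι := π₁ ^ g.1.val * π₂ ^ g.2.val with hPg
  set Qg : Equiv.Perm ι := κ₁ ^ g.1.val * κ₂ ^ g.2.val with hQg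
  have hTg : IsSignedAut H Pg Qg _ _ := isSignedAut_mul (isSignedAut_pow h₁ g.1.val) (isSignedAut_pow h₂ g.2.val)
  have hcR : Commute Pg π := (hc₁.pow_left _).mul_left (hc₂.pow_left _)
  have hcC : Commute Qg κ := (hc₁'.pow_left _).mul_left (hc₂'.pow_left _)
  have hPsq : Pg ^ 2 = 1 := by
    rw [hPg, pow_two, ← v4_label_add hi₁ hi₂ hcomm, v4_facts.1 g]; simp
  have hQsq : Qg ^ 2 = 1 := by
    rw [hQg, pow_two, ← v4_label_add hi₁' hi₂' hcomm', v4_facts.1 g]; simp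
  obtain ⟨x₁, hx₁⟩ : (univ.filter fun x => (Pg * π') x = x).Nonempty := by
    rw [← Finset.card_pos, hcr]; norm_num
  have hx₁' : (Pg * π') x₁ = x₁ := (Finset.mem_filter.mp hx₁).2
  obtain ⟨hcm, hcm'⟩ := inverting_involution_commute_label hH hι haut hπ hκ hne hρ hnρ hnρ' hμ hTg hcR hcC hPsq hQsq
    hs2 hs2' hrows hx₁'
  have eπ : π' = Pg * (Pg * π') := by rw [← mul_assoc, ← pow_two, hPsq, one_mul]
  have eκ : κ' = Qg * (Qg * κ') := by rw [← mul_assoc, ← pow_two, hQsq, one_mul]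
  refine ⟨?_, ?_⟩
  · rw [eπ, hcm.symm.mul_pow, hPsq, hs2, one_mul]
  · rw [eκ, hcm'.symm.mul_pow, hQsq, hs2', one_mul]

end indexfour

end Summit.Ventures.DiscreteObjects.Hadamard
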